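import Literature.NumberTheory.Transcendental.SemialgebraicDslope
import HarnessLib

/-!
# The logarithmic sector of the Kontsevich–Zagier dilation pencil, I: dilation integrals

For a Nash (`ℚ`-semialgebraic, real-analytic) function `Q > 0` on an open interval `(a, b) ⊇ [0,1]`
with logarithmic derivative `h = Q'/Q` (`HasDerivAt Q (h x · Q x) x`), the DILATION FUNCTION of the
one-dimensional cube integrand `h` (Kontsevich–Zagier 2001, §1.2: `v_h(ϖ) := ∫_{[0,1]¹} h(ϖ z) dz`,
the fibre of the dilation pencil at `ϖ`) is
  `v_h(ϖ) = (log Q(ϖ) − log Q(0))/ϖ`  (`ϖ ∈ (0,1]`),   `v_h(0) = h(0)`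
(`dilation_integral`, `dilation_integral_zero`; fundamental theorem of calculus with primitive
`y ↦ log Q(ϖy)/ϖ`, after transferring `[0,1]¹ ⊆ ℝ¹` to `[0,1]`, `setIntegral_cube_one`). The period
relation `v_h(1) = 0` is `Q(1) = Q(0)`. This file also records the elementary integral
`∫₀¹ dt/(1 + ct) = log(1 + c)/c` (`integral_inv_one_add_mul`), the derivative of the `n`-th root
`R = (Q/Q(0))^{1/n}`, `R' = R h/n` (`hasDerivAt_root`), and the mean value bound
`|dslope R 0| < 1` on `[0,1]` from `|R'| < 1` (`abs_dslope_lt_one`): the inputs of the kernel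
construction of `KZDilationLogSectorLift.lean` (the factorisation `v_h = (ϖ − 1)·∫ K(ϖ, ϖy) dy` with
ONE twisted-diagonal Nash kernel, the logarithmic sector of the lifting problem "vanishing cube period
⇒ functional factorisation in the dilation pencil").

## References

* M. Kontsevich, D. Zagier, *Periods*, in: Mathematics Unlimited — 2001 and Beyond, Springer
  (2001), §1.2. [`KontsevichZagier2001`]

Everything is proved; no `def`, no named fact.
-/

noncomputable section

open Set MeasureTheory Filter MvPolynomial
open scoped Topology
open Literature.ModelTheory.ExponentialFields

namespace Literature.NumberTheory.Transcendental

namespace KZ.DilationLogSector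

/-! ### One-dimensional integrals -/

/-- Transfer of an integral over the unit cube `[0,1]¹ ⊆ ℝ¹` to the unit interval
(`MeasurableEquiv.funUnique`, volume preserving). [folklore] -/
theorem setIntegral_cube_one (g : ℝ → ℝ) :
    (∫ z in Set.pi Set.univ (fun _ : Fin 1 => Icc (0:ℝ) 1), g (z 0)) = ∫ t in Icc (0:ℝ) 1, g t := by
  have hmp : MeasurePreserving (MeasurableEquiv.funUnique (Fin 1) ℝ) volume volume :=
    volume_preserving_funUnique (Fin 1) ℝ
  have hset : Set.pi Set.univ (fun _ : Fin 1 => Set.Icc (0:ℝ) 1) =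
      (MeasurableEquiv.funUnique (Fin 1) ℝ) ⁻¹' Set.Icc 0 1 := by
    ext z
    simp only [Set.mem_univ_pi, Fin.forall_fin_one, Set.mem_preimage]
    simp [MeasurableEquiv.funUnique, Fin.default_eq_zero]
  rw [hset, ← hmp.setIntegral_preimage_emb (MeasurableEquiv.funUnique (Fin 1) ℝ).measurableEmbedding
    g (Set.Icc 0 1)]
  rfl

/-- `∫₀¹ dt/(1 + ct) = log(1 + c)/c` for `c > −1`, `c ≠ 0` (fundamental theorem of calculus with
primitive `log(1 + ct)/c`). [folklore] -/
theorem integral_inv_one_add_mul {c : ℝ} (hc : -1 < c) (hc0 : c ≠ 0) :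
    (∫ t in (0:ℝ)..1, (1 + c * t)⁻¹) = Real.log (1 + c) / c := by
  have hpos : ∀ t ∈ Icc (0:ℝ) 1, 0 < 1 + c * t := by
    intro t ht
    rcases le_or_gt 0 c with h | h
    · have : 0 ≤ c * t := mul_nonneg h ht.1
      linarith
    · have : c * 1 ≤ c * t := mul_le_mul_of_nonpos_left ht.2 h.le
      linarith
  have hderiv : ∀ t ∈ uIcc (0:ℝ) 1,
      HasDerivAt (fun t => Real.log (1 + c * t) / c) ((1 + c * t)⁻¹) t := by
    intro t ht
    rw [uIcc_of_le zero_le_one] at ht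
    have h1 : HasDerivAt (fun t => 1 + c * t) c t := by
      simpa using ((hasDerivAt_id t).const_mul c).const_add 1
    have h2 := (h1.log (hpos t ht).ne').div_const c
    have h3 : c / (1 + c * t) / c = (1 + c * t)⁻¹ := by
      field_simp
    rw [h3] at h2
    exact h2
  rw [intervalIntegral.integral_eq_sub_of_hasDerivAt hderiv]
  · simp
  · apply ContinuousOn.intervalIntegrable
    rw [uIcc_of_le zero_le_one]
    exact ContinuousOn.inv₀ (by fun_prop) fun t ht => (hpos t ht).ne'


/-- For `-1 < c`, `∫₀¹ dt/(1 + ct)` equals `1` if `c = 0` and `log(1 + c)/c` otherwise, as a set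
integral over `[0,1]`. [folklore] -/
theorem setIntegral_inv_one_add_mul {c : ℝ} (hc : -1 < c) :
    (∫ t in Icc (0:ℝ) 1, (1 + c * t)⁻¹) = if c = 0 then 1 else Real.log (1 + c) / c := by
  rw [integral_Icc_eq_integral_Ioc, ← intervalIntegral.integral_of_le zero_le_one]
  split_ifs with h0
  · subst h0
    simp
  · exact integral_inv_one_add_mul hc h0

/-! ### The dilation function of a logarithmic derivative -/

section Data

variable {a b : ℝ} {Q h : ℝ → ℝ}

/-- The logarithmic derivative `h = Q'/Q` of a positive real-analytic `Q` is real-analytic.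
[folklore] -/
theorem analyticAt_logDeriv (hQa : ∀ x ∈ Ioo a b, AnalyticAt ℝ Q x) (hpos : ∀ x ∈ Ioo a b, 0 < Q x)
    (hder : ∀ x ∈ Ioo a b, HasDerivAt Q (h x * Q x) x) {x : ℝ} (hx : x ∈ Ioo a b) :
    AnalyticAt ℝ h x := by
  have heq : (fun y => deriv Q y / Q y) =ᶠ[𝓝 x] h := by
    filter_upwards [Ioo_mem_nhds hx.1 hx.2] with y hy
    rw [(hder y hy).deriv, mul_div_assoc, div_self (hpos y hy).ne', mul_one]
  exact (((hQa x hx).deriv).div (hQa x hx) (hpos x hx).ne').congr heq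

/-- Continuity of the logarithmic derivative on the interval. [folklore] -/
theorem continuousOn_logDeriv (hQa : ∀ x ∈ Ioo a b, AnalyticAt ℝ Q x)
    (hpos : ∀ x ∈ Ioo a b, 0 < Q x) (hder : ∀ x ∈ Ioo a b, HasDerivAt Q (h x * Q x) x) :
    ContinuousOn h (Ioo a b) := fun _ hx =>
  (analyticAt_logDeriv hQa hpos hder hx).continuousAt.continuousWithinAt

/-- **The dilation function of a logarithmic derivative.** For `ϖ ∈ (0,1]`,
`∫_{[0,1]¹} h(ϖ z) dz = (log Q(ϖ) − log Q(0))/ϖ` (fundamental theorem of calculus with primitive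
`y ↦ log Q(ϖy)/ϖ`). [cite: KontsevichZagier2001, §1.2] -/
theorem dilation_integral (ha : a < 0) (hb : 1 < b)
    (hQa : ∀ x ∈ Ioo a b, AnalyticAt ℝ Q x) (hpos : ∀ x ∈ Ioo a b, 0 < Q x)
    (hder : ∀ x ∈ Ioo a b, HasDerivAt Q (h x * Q x) x) {ϖ : ℝ} (hϖ : ϖ ∈ Ioc (0:ℝ) 1) :
    (∫ z in Set.pi Set.univ (fun _ : Fin 1 => Icc (0:ℝ) 1), h ((ϖ • z) 0)) =
      (Real.log (Q ϖ) - Real.log (Q 0)) / ϖ := by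
  have hϖ0 : ϖ ≠ 0 := hϖ.1.ne'
  have hmem : ∀ y ∈ Icc (0:ℝ) 1, ϖ * y ∈ Ioo a b := fun y hy =>
    ⟨lt_of_lt_of_le ha (mul_nonneg hϖ.1.le hy.1), lt_of_le_of_lt (mul_le_one₀ hϖ.2 hy.1 hy.2) hb⟩
  have key : (∫ z in Set.pi Set.univ (fun _ : Fin 1 => Icc (0:ℝ) 1), h ((ϖ • z) 0)) =
      ∫ t in Icc (0:ℝ) 1, h (ϖ * t) := by
    simp only [Pi.smul_apply, smul_eq_mul]
    exact setIntegral_cube_one (fun t => h (ϖ * t))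
  rw [key, integral_Icc_eq_integral_Ioc, ← intervalIntegral.integral_of_le zero_le_one]
  have hderiv : ∀ y ∈ uIcc (0:ℝ) 1,
      HasDerivAt (fun y => Real.log (Q (ϖ * y)) / ϖ) (h (ϖ * y)) y := by
    intro y hy
    rw [uIcc_of_le zero_le_one] at hy
    have h1 : HasDerivAt (fun y => ϖ * y) ϖ y := by simpa using (hasDerivAt_id y).const_mul ϖ
    have h2 : HasDerivAt (fun y => Q (ϖ * y)) (h (ϖ * y) * Q (ϖ * y) * ϖ) y :=
      (hder _ (hmem y hy)).comp y h1
    have h3 := (h2.log (hpos _ (hmem y hy)).ne').div_const ϖ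
    have h4 : h (ϖ * y) * Q (ϖ * y) * ϖ / Q (ϖ * y) / ϖ = h (ϖ * y) := by
      field_simp [(hpos _ (hmem y hy)).ne']
    rw [h4] at h3
    exact h3
  rw [intervalIntegral.integral_eq_sub_of_hasDerivAt hderiv]
  · simp only [mul_one, mul_zero]
    ring
  · apply ContinuousOn.intervalIntegrable
    rw [uIcc_of_le zero_le_one]
    exact (continuousOn_logDeriv hQa hpos hder).comp (by fun_prop) hmem

/-- At `ϖ = 0` the dilation function is the value `h 0` (the cube has volume one).
[cite: KontsevichZagier2001, §1.2] -/
theorem dilation_integral_zero :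
    (∫ z in Set.pi Set.univ (fun _ : Fin 1 => Icc (0:ℝ) 1), h (((0:ℝ) • z) 0)) = h 0 := by
  simp only [zero_smul, Pi.zero_apply]
  rw [setIntegral_cube_one (fun _ => h 0), setIntegral_const]
  simp

/-- **Derivative of the `n`-th root.** With `R := (Q/Q(0))^{1/n}` one has `R' = R·h/n` on the
interval. [folklore] -/
theorem hasDerivAt_root (hpos : ∀ x ∈ Ioo a b, 0 < Q x)
    (hder : ∀ x ∈ Ioo a b, HasDerivAt Q (h x * Q x) x) (h0 : (0:ℝ) ∈ Ioo a b) {n : ℕ} (hn : n ≠ 0)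
    {R : ℝ → ℝ} (hR : ∀ x, R x = (Q x * (Q 0)⁻¹) ^ ((n:ℝ)⁻¹)) {x : ℝ} (hx : x ∈ Ioo a b) :
    HasDerivAt R ((n:ℝ)⁻¹ * R x * h x) x := by
  have hQ0 : 0 < Q 0 := hpos 0 h0
  have hf : HasDerivAt (fun y => Q y * (Q 0)⁻¹) (h x * Q x * (Q 0)⁻¹) x := (hder x hx).mul_const _
  have hfx : 0 < Q x * (Q 0)⁻¹ := mul_pos (hpos x hx) (inv_pos.mpr hQ0)
  have h1 := hf.rpow_const (p := (n:ℝ)⁻¹) (Or.inl hfx.ne')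
  have hfun : (fun y => (Q y * (Q 0)⁻¹) ^ ((n:ℝ)⁻¹)) = R := funext fun y => (hR y).symm
  rw [hfun] at h1
  convert h1 using 1
  have hQx : Q x ≠ 0 := (hpos x hx).ne'
  have hQ0' : Q 0 ≠ 0 := hQ0.ne'
  rw [hR x, Real.rpow_sub_one hfx.ne']
  field_simp

/-- **Mean value bound for the difference quotient at `0`.** If `|R'| < 1` on `[0,1]`, then
`|dslope R 0| < 1` on `[0,1]`. [folklore] -/
theorem abs_dslope_lt_one {R R' : ℝ → ℝ}
    (hd : ∀ x ∈ Ioo a b, HasDerivAt R (R' x) x) (hsub : Icc (0:ℝ) 1 ⊆ Ioo a b)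
    (hsmall : ∀ x ∈ Icc (0:ℝ) 1, |R' x| < 1) {ϖ : ℝ} (hϖ : ϖ ∈ Icc (0:ℝ) 1) :
    |dslope R 0 ϖ| < 1 := by
  rcases hϖ.1.eq_or_lt with h | h
  · rw [← h, dslope_same, (hd 0 (hsub ⟨le_rfl, zero_le_one⟩)).deriv]
    exact hsmall 0 ⟨le_rfl, zero_le_one⟩
  · have hcont : ContinuousOn R (Icc 0 ϖ) := fun x hx =>
      (hd x (hsub ⟨hx.1, hx.2.trans hϖ.2⟩)).continuousAt.continuousWithinAt
    obtain ⟨ξ, hξ, hξeq⟩ := exists_hasDerivAt_eq_slope R R' h hcont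
      (fun x hx => hd x (hsub ⟨hx.1.le, hx.2.le.trans hϖ.2⟩))
    rw [dslope_of_ne _ h.ne', slope_def_field, ← hξeq]
    exact hsmall ξ ⟨hξ.1.le, hξ.2.le.trans hϖ.2⟩

end Data

end KZ.DilationLogSector

end Literature.NumberTheory.Transcendental
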